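import Mathlib
import HarnessLib

/-!
# Negative-definite configuration lattices: Artin's lemma, full support of dual cycles, and the STRICT drop of the
# dual self-intersection `c_E = −(E^*)²` on proper connected sub-configurations (K44S-VOLUME (L1)–(L3), kernel form)

[OURS · cell res-hironaka · LADDER-RESOLUTION L ★L-G4 W4.4 · res-L0-w44-lead-1 g7 (lead prover)] AI-written; weaker than
expert review; NOT a statement of the manuscript under review (Hironaka 2017). Def-free, fact-free linear algebra over `ℚ`,
stated on a function `N : ι → ι → ℚ` and finite index sets `S ⊆ U : Finset ι` (no `Matrix` API is used, so the lemmas apply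
verbatim to intersection matrices of exceptional configurations indexed by any type).

DICTIONARY. For an exceptional configuration `Γ = {E_i}_{i ∈ U}` of a resolution of a normal surface singularity put
`N i j := −(E_i · E_j)`: then `N` is symmetric, POSITIVE definite on `U` (negative definiteness of the intersection form),
with `N i j ≤ 0` for `i ≠ j`; «connected» = every proper non-empty `T ⊂ U` has an edge `N i j < 0` leaving it. The dual
cycle `E^*_U` of `E = E_e` (`E^*·E_j = −δ_{ej}`) has coefficient vector `x` with `∑_{j∈U} N i j * x j = δ_{ie}`, and
`c_E(U) := −(E^*_U)² = x e`. Hence: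
* `nonneg_of_mulVec_nonneg` = ARTIN'S LEMMA («anti-nef ⇒ effective»): `N x ≥ 0` on `S` ⇒ `x ≥ 0` on `S`;
* `pos_of_mulVec_nonneg` = FULL SUPPORT on a connected configuration: `N x ≥ 0`, `N x ≠ 0` ⇒ `x > 0` everywhere (K44S-VOLUME (L2));
* `dualEntry_lt_of_ssubset` = K44S-VOLUME (L3): for `e ∈ S ⊊ U`, both connected, the dual coefficient STRICTLY drops:
  `c_E(S) < c_E(U)`. Along an eternal divisorial thread `T_m ⊊ T_{m+1}` of normal surface germs (`v = ord_E` centred at every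
  stage) the resolution configuration of `T_{m+1}` is a proper connected sub-configuration (containing `E`) of that of `T_m`
  after point blow-ups (which leave `c_E` unchanged), so `m ↦ c_E(T_m)` strictly decreases and the valuation volume
  `vol_{T_m}(v) = 1/c_E(T_m)` strictly increases (memo `L/res-L0-w44-lead-1/K44S-VOLUME.md` v1.0 050816fb5cfee6ce; tri-2 L-VOL PASS).
Bears on: kill test `SurfaceTermination` stmt-16488 (residue `stub_initialPairOfConstantGenus`) and crux `NoZenoR` stmt-19943
slot 7 (NDT-BP) as a NECESSARY condition for eternity (SOURCE-C, res-L0-w44-plan-1 (ρ38l)). Counted 0.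
-/

namespace Summit.ResolutionOfSingularities.ResolutionOfSingularities.Theorems.NoZeno.LatticeVolume

-- single-problem summit: the doubled namespace component `ResolutionOfSingularities` is forced by the layout
set_option linter.dupNamespace false

open Finset

variable {ι : Type*} [DecidableEq ι]

/-- **Artin's lemma (Z-matrix form).** If `N` is positive definite on `S` with non-positive off-diagonal entries, then
`(N x)_i ≥ 0` for all `i ∈ S` forces `x_i ≥ 0` for all `i ∈ S` («an anti-nef cycle in a negative-definite configuration
is effective»). Proof: test positivity on the negative part `y = min(x,0)`. [folklore; this work: kernel form] -/
theorem nonneg_of_mulVec_nonneg (S : Finset ι) (N : ι → ι → ℚ)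
    (hoff : ∀ i ∈ S, ∀ j ∈ S, i ≠ j → N i j ≤ 0)
    (hpos : ∀ y : ι → ℚ, (∃ i ∈ S, y i ≠ 0) → 0 < ∑ i ∈ S, ∑ j ∈ S, y i * N i j * y j)
    (x : ι → ℚ) (hx : ∀ i ∈ S, 0 ≤ ∑ j ∈ S, N i j * x j) :
    ∀ i ∈ S, 0 ≤ x i := by
  by_contra h
  push Not at h
  obtain ⟨i₀, hi₀S, hi₀⟩ := h
  set y : ι → ℚ := fun i => min (x i) 0 with hy_def
  have hy_nonpos : ∀ i, y i ≤ 0 := fun i => min_le_right _ _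
  have hxy : ∀ i, 0 ≤ x i - y i := fun i => sub_nonneg.mpr (min_le_left _ _)
  have hyxy : ∀ i, y i * (x i - y i) = 0 := by
    intro i
    by_cases hxi : x i ≤ 0
    · simp [hy_def, min_eq_left hxi]
    · simp [hy_def, min_eq_right (le_of_lt (not_le.mp hxi))]
  -- `∑ y_i (N x)_i ≤ 0`
  have h1 : ∑ i ∈ S, y i * (∑ j ∈ S, N i j * x j) ≤ 0 :=
    Finset.sum_nonpos fun i hi => mul_nonpos_of_nonpos_of_nonneg (hy_nonpos i) (hx i hi)
  -- split `x = y + (x - y)`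
  have h2 : ∑ i ∈ S, y i * (∑ j ∈ S, N i j * x j) =
      (∑ i ∈ S, ∑ j ∈ S, y i * N i j * y j) + ∑ i ∈ S, ∑ j ∈ S, y i * N i j * (x j - y j) := by
    rw [← Finset.sum_add_distrib]
    refine Finset.sum_congr rfl fun i _ => ?_
    rw [Finset.mul_sum, ← Finset.sum_add_distrib]
    refine Finset.sum_congr rfl fun j _ => ?_
    ring
  -- the mixed term is `≥ 0`
  have h3 : 0 ≤ ∑ i ∈ S, ∑ j ∈ S, y i * N i j * (x j - y j) := by
    refine Finset.sum_nonneg fun i hi => Finset.sum_nonneg fun j hj => ?_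
    by_cases hij : i = j
    · subst hij
      have : y i * N i i * (x i - y i) = N i i * (y i * (x i - y i)) := by ring
      rw [this, hyxy i, mul_zero]
    · exact mul_nonneg (mul_nonneg_of_nonpos_of_nonpos (hy_nonpos i) (hoff i hi j hj hij)) (hxy j)
  have key : ∑ i ∈ S, ∑ j ∈ S, y i * N i j * y j ≤ 0 := by linarith
  have hyne : ∃ i ∈ S, y i ≠ 0 :=
    ⟨i₀, hi₀S, by simp [hy_def, min_eq_left hi₀.le, hi₀.ne]⟩
  exact absurd (hpos y hyne) (not_lt.mpr key)

/-- **Full support (K44S-VOLUME (L2)).** On a CONNECTED index set `S` (every proper non-empty `T ⊂ S` has an edge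
`N i j < 0` from `T` to `S ∖ T`), a vector with `N x ≥ 0` on `S` and `N x ≠ 0` somewhere on `S` is STRICTLY positive on
all of `S`. With `N x = δ_e` this says: the dual cycle `E^*` of a curve in a connected negative-definite configuration has
every coefficient `> 0`. [folklore; this work: kernel form] -/
theorem pos_of_mulVec_nonneg (S : Finset ι) (N : ι → ι → ℚ)
    (hoff : ∀ i ∈ S, ∀ j ∈ S, i ≠ j → N i j ≤ 0)
    (hpos : ∀ y : ι → ℚ, (∃ i ∈ S, y i ≠ 0) → 0 < ∑ i ∈ S, ∑ j ∈ S, y i * N i j * y j)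
    (hconn : ∀ T : Finset ι, T ⊆ S → T.Nonempty → T ≠ S → ∃ i ∈ T, ∃ j ∈ S, j ∉ T ∧ N i j < 0)
    (x : ι → ℚ) (hx : ∀ i ∈ S, 0 ≤ ∑ j ∈ S, N i j * x j)
    (hne : ∃ i ∈ S, 0 < ∑ j ∈ S, N i j * x j) :
    ∀ i ∈ S, 0 < x i := by
  have hnn := nonneg_of_mulVec_nonneg S N hoff hpos x hx
  -- the zero set `T`
  set T : Finset ι := S.filter fun i => x i = 0 with hT_def
  have hTS : T ⊆ S := Finset.filter_subset _ _
  by_contra hcon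
  push Not at hcon
  obtain ⟨i₁, hi₁S, hi₁⟩ := hcon
  have hx1 : x i₁ = 0 := le_antisymm hi₁ (hnn i₁ hi₁S)
  have hTne : T.Nonempty := ⟨i₁, by simp [hT_def, hi₁S, hx1]⟩
  by_cases hTS' : T = S
  · -- all of `x` vanishes on `S`: contradicts `hne`
    obtain ⟨i, hi, hi'⟩ := hne
    have : ∑ j ∈ S, N i j * x j = 0 := by
      refine Finset.sum_eq_zero fun j hj => ?_
      have hjT : j ∈ T := hTS' ▸ hj
      have : x j = 0 := by simpa [hT_def] using (Finset.mem_filter.mp hjT).2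
      rw [this, mul_zero]
    exact absurd this (ne_of_gt hi')
  · obtain ⟨i, hiT, j, hjS, hjT, hNij⟩ := hconn T hTS hTne hTS'
    have hiS : i ∈ S := hTS hiT
    have hxi : x i = 0 := by simpa [hT_def] using (Finset.mem_filter.mp hiT).2
    have hxj : 0 < x j := by
      have hxj0 : x j ≠ 0 := by
        intro h0
        exact hjT (by simp [hT_def, hjS, h0])
      exact lt_of_le_of_ne (hnn j hjS) (Ne.symm hxj0)
    -- `(N x)_i = N i j * x j + ∑_{l ≠ j} N i l * x l ≤ N i j * x j < 0`
    have hsplit : ∑ l ∈ S, N i l * x l = N i j * x j + ∑ l ∈ S.erase j, N i l * x l :=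
      (Finset.add_sum_erase S (fun l => N i l * x l) hjS).symm
    have hrest : ∑ l ∈ S.erase j, N i l * x l ≤ 0 := by
      refine Finset.sum_nonpos fun l hl => ?_
      have hlS : l ∈ S := Finset.mem_of_mem_erase hl
      by_cases hli : l = i
      · subst hli; rw [hxi, mul_zero]
      · exact mul_nonpos_of_nonpos_of_nonneg (hoff i hiS l hlS (Ne.symm hli)) (hnn l hlS)
    have hneg : N i j * x j < 0 := mul_neg_of_neg_of_pos hNij hxj
    have : ∑ l ∈ S, N i l * x l < 0 := by rw [hsplit]; linarith
    exact absurd (hx i hiS) (not_le.mpr this)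

/-- Positive definiteness restricts from `U` to a subset `S ⊆ U` (extend a vector on `S` by zero). [folklore] -/
theorem posDef_restrict (U S : Finset ι) (hSU : S ⊆ U) (N : ι → ι → ℚ)
    (hposU : ∀ y : ι → ℚ, (∃ i ∈ U, y i ≠ 0) → 0 < ∑ i ∈ U, ∑ j ∈ U, y i * N i j * y j) :
    ∀ y : ι → ℚ, (∃ i ∈ S, y i ≠ 0) → 0 < ∑ i ∈ S, ∑ j ∈ S, y i * N i j * y j := by
  intro y hy
  obtain ⟨i₀, hi₀, hyi₀⟩ := hy
  set y' : ι → ℚ := fun i => if i ∈ S then y i else 0 with hy'_def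
  have h := hposU y' ⟨i₀, hSU hi₀, by simp [hy'_def, hi₀, hyi₀]⟩
  have hrow : ∀ i, ∑ j ∈ U, y' i * N i j * y' j = ∑ j ∈ S, y' i * N i j * y j := by
    intro i
    rw [← Finset.sum_subset hSU (fun j _ hjS => by simp [hy'_def, hjS])]
    exact Finset.sum_congr rfl fun j hj => by simp [hy'_def, hj]
  have htot : ∑ i ∈ U, ∑ j ∈ U, y' i * N i j * y' j = ∑ i ∈ S, ∑ j ∈ S, y i * N i j * y j := by
    simp_rw [hrow]
    rw [← Finset.sum_subset hSU (fun i _ hiS => by simp [hy'_def, hiS])]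
    exact Finset.sum_congr rfl fun i hi => by simp [hy'_def, hi]
  rwa [htot] at h

/-- **K44S-VOLUME (L3), kernel form: the dual coefficient STRICTLY drops on a proper connected sub-configuration.**
`N` symmetric is not even needed; hypotheses: `N` positive definite on `U` with non-positive off-diagonal entries, `U` and
`S` connected, `e ∈ S ⊊ U`; `x` solves `N x = δ_e` on `U` and `y` solves `N_S y = δ_e` on `S`. Then `y e < x e`, i.e.
`c_E(S) < c_E(U)`. Proof: `x > 0` on `U` (full support); on `S`, `N_S (x − y) = −(N_{S,U∖S} x) ≥ 0` and `≠ 0` at a vertex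
of `S` adjacent to `U ∖ S`; full support on `S` gives `x − y > 0` on `S`. [this work] -/
theorem dualEntry_lt_of_ssubset (U S : Finset ι) (hSU : S ⊆ U) (hne : S ≠ U) (e : ι) (he : e ∈ S)
    (N : ι → ι → ℚ)
    (hoff : ∀ i ∈ U, ∀ j ∈ U, i ≠ j → N i j ≤ 0)
    (hposU : ∀ y : ι → ℚ, (∃ i ∈ U, y i ≠ 0) → 0 < ∑ i ∈ U, ∑ j ∈ U, y i * N i j * y j)
    (hconnU : ∀ T : Finset ι, T ⊆ U → T.Nonempty → T ≠ U → ∃ i ∈ T, ∃ j ∈ U, j ∉ T ∧ N i j < 0)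
    (hconnS : ∀ T : Finset ι, T ⊆ S → T.Nonempty → T ≠ S → ∃ i ∈ T, ∃ j ∈ S, j ∉ T ∧ N i j < 0)
    (x : ι → ℚ) (hx : ∀ i ∈ U, ∑ j ∈ U, N i j * x j = if i = e then 1 else 0)
    (y : ι → ℚ) (hy : ∀ i ∈ S, ∑ j ∈ S, N i j * y j = if i = e then 1 else 0) :
    y e < x e := by
  have hoffS : ∀ i ∈ S, ∀ j ∈ S, i ≠ j → N i j ≤ 0 := fun i hi j hj hij => hoff i (hSU hi) j (hSU hj) hij
  have hposS := posDef_restrict U S hSU N hposU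
  -- `x > 0` on `U`
  have hxpos : ∀ i ∈ U, 0 < x i := by
    refine pos_of_mulVec_nonneg U N hoff hposU hconnU x (fun i hi => ?_) ⟨e, hSU he, ?_⟩
    · rw [hx i hi]; split_ifs <;> norm_num
    · rw [hx e (hSU he)]; simp
  -- the difference `z = x - y` on `S`
  set z : ι → ℚ := fun i => x i - y i with hz_def
  -- row identity on `S`: `∑_{j∈S} N i j * z j = -(∑_{j ∈ U \ S} N i j * x j)`
  have hrowx : ∀ i ∈ S, ∑ j ∈ S, N i j * x j = (if i = e then 1 else 0) - ∑ j ∈ U \ S, N i j * x j := by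
    intro i hi
    have := Finset.sum_sdiff hSU (f := fun j => N i j * x j)
    rw [hx i (hSU hi)] at this
    linarith
  have hrowz : ∀ i ∈ S, ∑ j ∈ S, N i j * z j = -(∑ j ∈ U \ S, N i j * x j) := by
    intro i hi
    have : ∑ j ∈ S, N i j * z j = (∑ j ∈ S, N i j * x j) - ∑ j ∈ S, N i j * y j := by
      rw [← Finset.sum_sub_distrib]
      exact Finset.sum_congr rfl fun j _ => by simp [hz_def]; ring
    rw [this, hrowx i hi, hy i hi]
    ring
  -- the boundary term is `≤ 0` termwise …
  have hbd : ∀ i ∈ S, ∑ j ∈ U \ S, N i j * x j ≤ 0 := by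
    intro i hi
    refine Finset.sum_nonpos fun j hj => ?_
    have hjU : j ∈ U := (Finset.mem_sdiff.mp hj).1
    have hjS : j ∉ S := (Finset.mem_sdiff.mp hj).2
    have hij : i ≠ j := fun h => hjS (h ▸ hi)
    exact mul_nonpos_of_nonpos_of_nonneg (hoff i (hSU hi) j hjU hij) (hxpos j hjU).le
  -- … and `< 0` at a vertex of `S` adjacent to `U \ S`
  have hSne : S.Nonempty := ⟨e, he⟩
  obtain ⟨i₁, hi₁S, j₁, hj₁U, hj₁S, hN⟩ := hconnU S hSU hSne hne
  have hbd₁ : ∑ j ∈ U \ S, N i₁ j * x j < 0 := by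
    have hj₁ : j₁ ∈ U \ S := Finset.mem_sdiff.mpr ⟨hj₁U, hj₁S⟩
    have hsplit : ∑ j ∈ U \ S, N i₁ j * x j = N i₁ j₁ * x j₁ + ∑ j ∈ (U \ S).erase j₁, N i₁ j * x j :=
      (Finset.add_sum_erase _ (fun j => N i₁ j * x j) hj₁).symm
    have hrest : ∑ j ∈ (U \ S).erase j₁, N i₁ j * x j ≤ 0 := by
      refine Finset.sum_nonpos fun j hj => ?_
      have hj' : j ∈ U \ S := Finset.mem_of_mem_erase hj
      have hjU : j ∈ U := (Finset.mem_sdiff.mp hj').1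
      have hjS : j ∉ S := (Finset.mem_sdiff.mp hj').2
      have hij : i₁ ≠ j := fun h => hjS (h ▸ hi₁S)
      exact mul_nonpos_of_nonpos_of_nonneg (hoff i₁ (hSU hi₁S) j hjU hij) (hxpos j hjU).le
    have hneg : N i₁ j₁ * x j₁ < 0 := mul_neg_of_neg_of_pos hN (hxpos j₁ hj₁U)
    rw [hsplit]; linarith
  -- full support on `S` for `z`
  have hzpos : ∀ i ∈ S, 0 < z i := by
    refine pos_of_mulVec_nonneg S N hoffS hposS hconnS z (fun i hi => ?_) ⟨i₁, hi₁S, ?_⟩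
    · rw [hrowz i hi]; linarith [hbd i hi]
    · rw [hrowz i₁ hi₁S]; linarith
  have := hzpos e he
  simp only [hz_def] at this
  linarith


/-! ## §2 Integrality of the dual coefficient and divergence of the discriminants (K44S-VOLUME §2 (c)) -/

/-- **Adjugate identity.** If `A x = b` then `det A • x = adj(A) b` (no invertibility needed). [folklore] -/
theorem det_smul_eq_adjugate_mulVec {n : Type*} [Fintype n] [DecidableEq n] (A : Matrix n n ℚ) (x b : n → ℚ)
    (h : A.mulVec x = b) : A.det • x = A.adjugate.mulVec b := by
  rw [← h, Matrix.mulVec_mulVec, Matrix.adjugate_mul, Matrix.smul_mulVec, Matrix.one_mulVec]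

/-- **Integrality (K44S-VOLUME (L3), denominators).** For an INTEGER matrix `M` (e.g. `−`(intersection matrix)) and a
rational solution of `M x = δ_e`, every `x i * det M` is an integer (an entry of the adjugate); in particular
`c_E = x e ∈ (1/|det M|)·ℤ`. [folklore; this work: kernel form] -/
theorem dualEntry_mul_det_mem_int {n : Type*} [Fintype n] [DecidableEq n] (M : Matrix n n ℤ) (e : n) (x : n → ℚ)
    (hx : (M.map (Int.castRingHom ℚ)).mulVec x = Pi.single e 1) (i : n) :
    ∃ z : ℤ, x i * (M.det : ℚ) = z := by
  have h := det_smul_eq_adjugate_mulVec (M.map (Int.castRingHom ℚ)) x (Pi.single e 1) hx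
  have hdet : (M.map (Int.castRingHom ℚ)).det = (M.det : ℚ) := by
    rw [← RingHom.mapMatrix_apply, ← RingHom.map_det]; rfl
  have hadj : (M.map (Int.castRingHom ℚ)).adjugate = M.adjugate.map (Int.castRingHom ℚ) := by
    rw [← RingHom.mapMatrix_apply, ← RingHom.mapMatrix_apply, RingHom.map_adjugate]
  have hi := congr_fun h i
  simp only [Pi.smul_apply, smul_eq_mul, hdet, hadj, Matrix.mulVec, dotProduct, Matrix.map_apply,
    Pi.single_apply, mul_ite, mul_one, mul_zero, Finset.sum_ite_eq', Finset.mem_univ, if_true] at hi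
  exact ⟨M.adjugate i e, by rw [mul_comm]; exact_mod_cast hi⟩

/-- **No infinite strict descent with a common denominator.** A strictly decreasing sequence of positive rationals
whose members all lie in `(1/D)·ℤ` for one `D > 0` does not exist. [folklore] -/
theorem not_strictAnti_pos_of_common_denominator (c : ℕ → ℚ) (hpos : ∀ m, 0 < c m) (hanti : StrictAnti c)
    (D : ℕ) (hD : 0 < D) (hint : ∀ m, ∃ z : ℤ, c m * D = z) : False := by
  choose z hz using hint
  have hzpos : ∀ m, 0 < z m := by
    intro m
    have : (0 : ℚ) < c m * D := mul_pos (hpos m) (by exact_mod_cast hD)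
    rw [hz m] at this
    exact_mod_cast this
  have hzanti : ∀ m, z (m + 1) < z m := by
    intro m
    have : c (m + 1) * D < c m * D := mul_lt_mul_of_pos_right (hanti (Nat.lt_succ_self m)) (by exact_mod_cast hD)
    rw [hz, hz] at this
    exact_mod_cast this
  -- `z m ≤ z 0 - m`, impossible for `m > z 0`
  have hle : ∀ m : ℕ, z m ≤ z 0 - m := by
    intro m
    induction m with
    | zero => simp
    | succ m ih => have := hzanti m; push_cast; omega
  have h0 := hzpos (Int.toNat (z 0) + 1)
  have h1 := hle (Int.toNat (z 0) + 1)
  push_cast at h1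
  omega

/-- **Discriminant divergence (K44S-VOLUME §2 (c)).** If `c : ℕ → ℚ` is positive and strictly decreasing and
`c m * d m ∈ ℤ` with `0 < d m` for every `m` (along an eternal divisorial thread: `c m = c_E(T_m)`, `d m = |det Λ(T_m)|`),
then the `d m` are UNBOUNDED. [this work] -/
theorem denominators_unbounded (c : ℕ → ℚ) (hpos : ∀ m, 0 < c m) (hanti : StrictAnti c) (d : ℕ → ℕ)
    (hd : ∀ m, 0 < d m) (hint : ∀ m, ∃ z : ℤ, c m * d m = z) (B : ℕ) : ∃ m, B < d m := by
  by_contra hB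
  push Not at hB
  refine not_strictAnti_pos_of_common_denominator c hpos hanti (Nat.factorial B) (Nat.factorial_pos B) fun m => ?_
  obtain ⟨z, hz⟩ := hint m
  obtain ⟨q, hq⟩ := Nat.dvd_factorial (hd m) (hB m)
  refine ⟨z * q, ?_⟩
  rw [hq]
  push_cast
  rw [← mul_assoc, hz]


/-! ## §3 Invariance of the dual coefficient under a point blow-up (K44S-VOLUME (L1)) -/

/-- **Blow-up invariance (K44S-VOLUME (L1)), matrix form.** Blowing up a closed point meeting the curves `E_j` with
multiplicities `m j` adjoins a `(−1)`-vertex `f ∉ U`: the new form is `N' f f = 1`, `N' i f = N' f i = −m i`,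
`N' i j = N i j + m i * m j` on `U` (strict transforms: `E_i'·E_j' = E_i·E_j − m_i m_j`, `E_i'·F = m_i`, `F² = −1`). If `x`
solves `N x = δ_e` on `U` (`e ∈ U`), then `x'` := `x` on `U` and `x' f = ∑_{j∈U} m j * x j` solves `N' x' = δ_e` on `insert f U`;
in particular the dual coefficient `c_E = x e = x' e` is unchanged. [folklore; this work: kernel form] -/
theorem dual_insert_of_blowup (U : Finset ι) (f e : ι) (hf : f ∉ U) (he : e ∈ U)
    (N N' : ι → ι → ℚ) (m : ι → ℚ) (x x' : ι → ℚ)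
    (hN'U : ∀ i ∈ U, ∀ j ∈ U, N' i j = N i j + m i * m j)
    (hN'f : ∀ i ∈ U, N' i f = -m i) (hN'f' : ∀ i ∈ U, N' f i = -m i) (hN'ff : N' f f = 1)
    (hx : ∀ i ∈ U, ∑ j ∈ U, N i j * x j = if i = e then 1 else 0)
    (hx'U : ∀ i ∈ U, x' i = x i) (hx'f : x' f = ∑ j ∈ U, m j * x j) :
    ∀ i ∈ insert f U, ∑ j ∈ insert f U, N' i j * x' j = if i = e then 1 else 0 := by
  intro i hi
  rw [Finset.sum_insert hf]
  rcases Finset.mem_insert.mp hi with rfl | hiU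
  · -- the new row
    have hfe : i ≠ e := fun h => hf (h ▸ he)
    rw [if_neg hfe, hN'ff, hx'f, one_mul]
    have : ∑ j ∈ U, N' i j * x' j = ∑ j ∈ U, (-(m j * x j)) := by
      refine Finset.sum_congr rfl fun j hj => ?_
      rw [hN'f' j hj, hx'U j hj]; ring
    rw [this, Finset.sum_neg_distrib]
    ring
  · -- an old row
    have hif : i ≠ f := fun h => hf (h ▸ hiU)
    rw [hN'f i hiU, hx'f]
    have : ∑ j ∈ U, N' i j * x' j = (∑ j ∈ U, N i j * x j) + m i * ∑ j ∈ U, m j * x j := by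
      rw [Finset.mul_sum, ← Finset.sum_add_distrib]
      refine Finset.sum_congr rfl fun j hj => ?_
      rw [hN'U i hiU j hj, hx'U j hj]; ring
    rw [this, hx i hiU]
    ring

end Summit.ResolutionOfSingularities.ResolutionOfSingularities.Theorems.NoZeno.LatticeVolume
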